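import Mathlib.MeasureTheory.Integral.Bochner.Basic
import Mathlib.MeasureTheory.Function.L1Space.Integrable
import Mathlib.MeasureTheory.Group.Arithmetic
import Mathlib.MeasureTheory.Constructions.BorelSpace.Order
import Mathlib.Data.Finset.Max
import Mathlib.Algebra.Order.BigOperators.Ring.Finset
import Mathlib.Tactic.Positivity
import Mathlib.Tactic.Ring
import Mathlib.Tactic.Linarith
import Literature.ComputerArithmetic.ConnollyHighamMary2021.ProbabilisticBounds
import HarnessLib

/-!
# Proofs of CHM21 Lemma 4.12 / Theorem 4.13 and El Arar et al. Lemma 3.1(3) from the SR error model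

Source statements: [ConnollyHighamMary2021] Lemma 4.12 (`E ∏ₖ(1 + δₖ) = 1` for mean-independent
mean-zero errors), Theorem 4.13 (`E ŝ = s` for SR recursive summation / inner products / matrix–vector
products in the standard model), and [ArarEtAl2023] Lemma 3.1(3)
(`V(∏_{k∈K}(1 + δₖ)) ≤ (1 + u²)^{|K|} − 1`).

This file DISCHARGES the named facts `productMeanOne`, `recursiveSumUnbiased` and
`productVarianceBound` of `ProbabilisticBounds`: each is proved here from the error model
`SRErrorModel μ u δ` (bounded, measurable, mean-independent errors) on a probability space, following
the papers' arguments (conditioning on the earlier errors = mean independence applied to the bounded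
measurable functional `∏_{k∈s}(1 + δₖ)` of `δ_{<m}`, `m = max K`; induction on `max K`).
-/

namespace Literature.ComputerArithmetic.ConnollyHighamMary2021

open MeasureTheory Finset

variable {Ω : Type*} [MeasurableSpace Ω] {μ : Measure Ω} {u : ℝ} {δ : ℕ → Ω → ℝ}

/-! ### Private plumbing: clipping, measurability, bounds, integrability -/

/-- [folklore] clipping to `[−u, u]` (plumbing for the mean-independence functional). -/
private def clip (u t : ℝ) : ℝ := max (-u) (min t u)

/-- [folklore] -/
private theorem abs_clip_le (u t : ℝ) : |clip u t| ≤ |u| := by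
  unfold clip
  rcases le_or_gt 0 u with h | h
  · rw [abs_of_nonneg h, abs_le]
    exact ⟨le_max_left _ _, max_le (by linarith) (min_le_right _ _)⟩
  · have : max (-u) (min t u) = -u := max_eq_left (by linarith [min_le_right t u])
    rw [abs_of_neg h, this, abs_of_pos (by linarith)]

/-- [folklore] -/
private theorem clip_eq_self {u t : ℝ} (h : |t| ≤ u) : clip u t = t := by
  rw [abs_le] at h
  unfold clip
  rw [min_eq_left h.2, max_eq_right h.1]

/-- [folklore] -/
private theorem measurable_clip (u : ℝ) : Measurable (clip u) :=
  (measurable_const.max (measurable_id.min measurable_const))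

/-- [folklore] coordinate extension `Fin m → ℝ` to `ℕ → ℝ` (zero beyond `m`). -/
private def ext {m : ℕ} (v : Fin m → ℝ) (k : ℕ) : ℝ := if h : k < m then v ⟨k, h⟩ else 0

/-- [folklore] -/
private theorem measurable_ext {m : ℕ} (k : ℕ) : Measurable (fun v : Fin m → ℝ => ext v k) := by
  unfold ext
  by_cases h : k < m
  · simp only [dif_pos h]; exact measurable_pi_apply _
  · simp only [dif_neg h]; exact measurable_const

/-- [folklore] **Mean independence applied to a product functional of the earlier errors**: for a
measurable `φ` bounded by `B ≥ 0` on `[−|u|, |u|]` and indices `s` all below `m`,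
`E[(∏_{k∈s} φ(δₖ)) · δₘ] = 0`. -/
private theorem integral_prod_mul_eq_zero (h : SRErrorModel μ u δ) {φ : ℝ → ℝ} (hφ : Measurable φ)
    {B : ℝ} (hφB : ∀ t, |t| ≤ |u| → |φ t| ≤ B) {s : Finset ℕ} {m : ℕ}
    (hs : ∀ k ∈ s, k < m) : ∫ ω, (∏ k ∈ s, φ (δ k ω)) * δ m ω ∂μ = 0 := by
  set g : (Fin m → ℝ) → ℝ := fun v => ∏ k ∈ s, φ (clip u (ext v k)) with hg
  have hgm : Measurable g :=
    Finset.measurable_prod s (fun k _ => hφ.comp ((measurable_clip u).comp (measurable_ext k)))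
  have hgb : ∃ C, ∀ v, |g v| ≤ C := by
    refine ⟨B ^ s.card, fun v => ?_⟩
    rw [hg]; dsimp only
    rw [Finset.abs_prod]
    calc ∏ k ∈ s, |φ (clip u (ext v k))| ≤ ∏ _k ∈ s, B :=
          Finset.prod_le_prod (fun _ _ => abs_nonneg _) (fun k _ => hφB _ (abs_clip_le u _))
      _ = B ^ s.card := Finset.prod_const B
  have key := h.meanIndep m g hgm hgb
  have hgδ : ∀ ω, g (fun i => δ i ω) = ∏ k ∈ s, φ (δ k ω) := by
    intro ω
    rw [hg]; dsimp only
    refine Finset.prod_congr rfl (fun k hk => ?_)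
    congr 1
    unfold ext
    rw [dif_pos (hs k hk)]
    exact clip_eq_self (h.bounded k ω)
  simp_rw [hgδ] at key
  exact key

/-- [folklore] `|u|`-bound on the errors. -/
private theorem abs_delta_le (h : SRErrorModel μ u δ) (k : ℕ) (ω : Ω) : |δ k ω| ≤ |u| :=
  (h.bounded k ω).trans (le_abs_self u)

/-- [folklore] measurability of `∏_{k∈s} φ(δₖ)`. -/
private theorem measurable_prod_comp (h : SRErrorModel μ u δ) {φ : ℝ → ℝ} (hφ : Measurable φ)
    (s : Finset ℕ) : Measurable (fun ω => ∏ k ∈ s, φ (δ k ω)) :=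
  Finset.measurable_prod s (fun k _ => hφ.comp (h.measurable k))

/-- [folklore] bound on `∏_{k∈s} φ(δₖ)`. -/
private theorem abs_prod_comp_le (h : SRErrorModel μ u δ) {φ : ℝ → ℝ} {B : ℝ}
    (hφB : ∀ t, |t| ≤ |u| → |φ t| ≤ B) (s : Finset ℕ) (ω : Ω) :
    |∏ k ∈ s, φ (δ k ω)| ≤ B ^ s.card := by
  rw [Finset.abs_prod]
  calc ∏ k ∈ s, |φ (δ k ω)| ≤ ∏ _k ∈ s, B :=
        Finset.prod_le_prod (fun _ _ => abs_nonneg _) (fun k _ => hφB _ (abs_delta_le h k ω))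
    _ = B ^ s.card := Finset.prod_const B

/-- [folklore] integrability of `∏_{k∈s} φ(δₖ)` on a probability space. -/
private theorem integrable_prod_comp [IsProbabilityMeasure μ] (h : SRErrorModel μ u δ) {φ : ℝ → ℝ}
    (hφ : Measurable φ) {B : ℝ} (hφB : ∀ t, |t| ≤ |u| → |φ t| ≤ B) (s : Finset ℕ) :
    Integrable (fun ω => ∏ k ∈ s, φ (δ k ω)) μ := by
  refine Integrable.of_mem_Icc (-(B ^ s.card)) (B ^ s.card)
    (measurable_prod_comp h hφ s).aemeasurable (ae_of_all _ (fun ω => ?_))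
  exact abs_le.mp (abs_prod_comp_le h hφB s ω)

/-- [folklore] integrability of `(∏_{k∈s} φ(δₖ)) · δₘ`. -/
private theorem integrable_prod_comp_mul [IsProbabilityMeasure μ] (h : SRErrorModel μ u δ)
    {φ : ℝ → ℝ} (hφ : Measurable φ) {B : ℝ} (hφB : ∀ t, |t| ≤ |u| → |φ t| ≤ B) (s : Finset ℕ)
    (m : ℕ) : Integrable (fun ω => (∏ k ∈ s, φ (δ k ω)) * δ m ω) μ := by
  have h1 := integrable_prod_comp h hφ hφB s
  refine h1.mul_bdd (c := |u|) (h.measurable m).aestronglyMeasurable (ae_of_all _ (fun ω => ?_))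
  rw [Real.norm_eq_abs]; exact abs_delta_le h m ω

/-- [folklore] integrability of `(∏_{k∈s} φ(δₖ)) · δₘ²`. -/
private theorem integrable_prod_comp_mul_sq [IsProbabilityMeasure μ] (h : SRErrorModel μ u δ)
    {φ : ℝ → ℝ} (hφ : Measurable φ) {B : ℝ} (hφB : ∀ t, |t| ≤ |u| → |φ t| ≤ B) (s : Finset ℕ)
    (m : ℕ) : Integrable (fun ω => (∏ k ∈ s, φ (δ k ω)) * δ m ω ^ 2) μ := by
  have h1 := integrable_prod_comp h hφ hφB s
  refine h1.mul_bdd (c := |u| ^ 2) ((h.measurable m).pow_const 2).aestronglyMeasurable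
    (ae_of_all _ (fun ω => ?_))
  rw [Real.norm_eq_abs, abs_pow]
  exact pow_le_pow_left₀ (abs_nonneg _) (abs_delta_le h m ω) 2

/-- [folklore] the two functionals used: `φ = 1 + t` is bounded by `1 + |u|` … -/
private theorem bound_one_add (t : ℝ) (ht : |t| ≤ |u|) : |1 + t| ≤ 1 + |u| :=
  (abs_add_le 1 t).trans (by rw [abs_one]; linarith)

/-- [folklore] … and `φ = (1 + t)²` by `(1 + |u|)²`. -/
private theorem bound_one_add_sq (t : ℝ) (ht : |t| ≤ |u|) : |(1 + t) ^ 2| ≤ (1 + |u|) ^ 2 := by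
  rw [abs_pow]
  exact pow_le_pow_left₀ (abs_nonneg _) (bound_one_add t ht) 2

/-- [folklore] -/
private theorem measurable_one_add : Measurable (fun t : ℝ => 1 + t) := measurable_const.add measurable_id

/-- [folklore] -/
private theorem measurable_one_add_sq : Measurable (fun t : ℝ => (1 + t) ^ 2) :=
  (measurable_const.add measurable_id).pow_const 2

/-! ### The discharges -/

/-- **CHM21 Lemma 4.12 holds in the SR error model** (discharge of the named fact `productMeanOne`):
`E ∏_{k∈K}(1 + δₖ) = 1`. Proof: induction on `max K`; `∏_{insert m s} = ∏_s + (∏_s)·δₘ` and the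
second term has mean zero by mean independence. [cite: ConnollyHighamMary2021, Lemma 4.12] -/
theorem productMeanOne_holds : productMeanOne := by
  intro Ω _ μ _ u δ h K
  classical
  induction K using Finset.induction_on_max with
  | empty => simp
  | insert m s hlt ih =>
    have hm : m ∉ s := fun hm => lt_irrefl _ (hlt m hm)
    have hsplit : ∀ ω, ∏ k ∈ insert m s, (1 + δ k ω)
        = (∏ k ∈ s, (1 + δ k ω)) + (∏ k ∈ s, (1 + δ k ω)) * δ m ω := by
      intro ω; rw [Finset.prod_insert hm]; ring
    simp_rw [hsplit]
    rw [integral_add (integrable_prod_comp h measurable_one_add bound_one_add s)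
      (integrable_prod_comp_mul h measurable_one_add bound_one_add s m), ih,
      integral_prod_mul_eq_zero h measurable_one_add bound_one_add hlt, add_zero]

/-- **CHM21 Theorem 4.13 (summation case) holds in the SR error model** (discharge of
`recursiveSumUnbiased`): `E ∑ᵢ xᵢ ∏_{k∈Kᵢ}(1 + δₖ) = ∑ᵢ xᵢ`, by linearity and Lemma 4.12.
[cite: ConnollyHighamMary2021, Thm. 4.13] -/
theorem recursiveSumUnbiased_holds : recursiveSumUnbiased := by
  intro Ω _ μ _ u δ h n x K
  rw [integral_finsetSum _ (fun i _ =>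
    (integrable_prod_comp h measurable_one_add bound_one_add (K i)).const_mul (x i))]
  refine Finset.sum_congr rfl (fun i _ => ?_)
  rw [integral_const_mul, productMeanOne_holds Ω μ u δ h (K i), mul_one]

/-- [folklore] second-moment growth: `E ∏_{k∈K}(1 + δₖ)² ≤ (1 + u²)^{|K|}`. -/
private theorem integral_prod_sq_le [IsProbabilityMeasure μ] (h : SRErrorModel μ u δ)
    (K : Finset ℕ) : ∫ ω, ∏ k ∈ K, (1 + δ k ω) ^ 2 ∂μ ≤ (1 + u ^ 2) ^ K.card := by
  classical
  induction K using Finset.induction_on_max with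
  | empty => simp
  | insert m s hlt ih =>
    have hm : m ∉ s := fun hm => lt_irrefl _ (hlt m hm)
    have hsplit : ∀ ω, ∏ k ∈ insert m s, (1 + δ k ω) ^ 2
        = ((∏ k ∈ s, (1 + δ k ω) ^ 2) + 2 * ((∏ k ∈ s, (1 + δ k ω) ^ 2) * δ m ω))
          + (∏ k ∈ s, (1 + δ k ω) ^ 2) * δ m ω ^ 2 := by
      intro ω; rw [Finset.prod_insert hm]; ring
    simp_rw [hsplit]
    have iQ := integrable_prod_comp h measurable_one_add_sq bound_one_add_sq s
    have iQd := integrable_prod_comp_mul h measurable_one_add_sq bound_one_add_sq s m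
    have iQd2 := integrable_prod_comp_mul_sq h measurable_one_add_sq bound_one_add_sq s m
    rw [integral_add ?i1 iQd2, integral_add iQ (iQd.const_mul 2), integral_const_mul,
      integral_prod_mul_eq_zero h measurable_one_add_sq bound_one_add_sq hlt,
      mul_zero, add_zero]
    case i1 => exact iQ.add (iQd.const_mul 2)
    -- `∫ Q·δₘ² ≤ u² ∫ Q` since `Q ≥ 0` and `δₘ² ≤ u²`
    have hQd2 : ∫ ω, (∏ k ∈ s, (1 + δ k ω) ^ 2) * δ m ω ^ 2 ∂μ
        ≤ ∫ ω, u ^ 2 * ∏ k ∈ s, (1 + δ k ω) ^ 2 ∂μ := by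
      refine integral_mono iQd2 (iQ.const_mul _) (fun ω => ?_)
      have hQ : 0 ≤ ∏ k ∈ s, (1 + δ k ω) ^ 2 := Finset.prod_nonneg (fun _ _ => sq_nonneg _)
      have hd : δ m ω ^ 2 ≤ u ^ 2 := by
        have := h.bounded m ω
        rw [← sq_abs, ← sq_abs u]
        exact pow_le_pow_left₀ (abs_nonneg _) (this.trans (le_abs_self u)) 2
      calc (∏ k ∈ s, (1 + δ k ω) ^ 2) * δ m ω ^ 2 ≤ (∏ k ∈ s, (1 + δ k ω) ^ 2) * u ^ 2 :=
            mul_le_mul_of_nonneg_left hd hQ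
        _ = u ^ 2 * ∏ k ∈ s, (1 + δ k ω) ^ 2 := mul_comm _ _
    rw [integral_const_mul] at hQd2
    rw [Finset.card_insert_of_notMem hm, pow_succ]
    have hI0 : 0 ≤ ∫ ω, ∏ k ∈ s, (1 + δ k ω) ^ 2 ∂μ :=
      integral_nonneg (fun ω => Finset.prod_nonneg (fun _ _ => sq_nonneg _))
    nlinarith [ih, hQd2, hI0, sq_nonneg u]

/-- **El Arar et al. Lemma 3.1(3) holds in the SR error model** (discharge of `productVarianceBound`):
`E(∏_{k∈K}(1 + δₖ) − 1)² ≤ (1 + u²)^{|K|} − 1 = γ_{|K|}(u²)`, since `E ∏(1+δₖ) = 1` and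
`E ∏(1+δₖ)² ≤ (1+u²)^{|K|}` (induction on `max K`, mean independence, `δₘ² ≤ u²`).
[cite: ArarEtAl2023, Lemma 3.1] -/
theorem productVarianceBound_holds : productVarianceBound := by
  intro Ω _ μ _ u δ h K
  have hP := productMeanOne_holds Ω μ u δ h K
  have iP := integrable_prod_comp h measurable_one_add bound_one_add K
  have iQ := integrable_prod_comp h measurable_one_add_sq bound_one_add_sq K
  have hsplit : ∀ ω, ((∏ k ∈ K, (1 + δ k ω)) - 1) ^ 2
      = ((∏ k ∈ K, (1 + δ k ω) ^ 2) - 2 * ∏ k ∈ K, (1 + δ k ω)) + 1 := by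
    intro ω; rw [Finset.prod_pow]; ring
  simp_rw [hsplit]
  rw [integral_add ?i1 (integrable_const 1), integral_sub iQ (iP.const_mul 2),
    integral_const_mul, hP]
  case i1 => exact iQ.sub (iP.const_mul 2)
  have h1 : ∫ _ : Ω, (1 : ℝ) ∂μ = 1 := by simp
  rw [h1]
  unfold gammaSq
  linarith [integral_prod_sq_le h K]

end Literature.ComputerArithmetic.ConnollyHighamMary2021
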